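import Summits.HubbardSuperconductivity.HubbardSuperconductivity.Theorems.InfiniteVolumeFirstCoarseTightnessBlockPairGramBound
import Summits.HubbardSuperconductivity.HubbardSuperconductivity.Theorems.InfiniteVolumeFirstCoarseTightnessAggregate
import Literature.MathematicalPhysics.QuantumLattice.BlockKernelBridge
import Literature.MathematicalPhysics.QuantumLattice.DirichletBlockLevels
import Literature.Probability.LatticeModels.LatticeGreenRiemannSum

/-!
# The mesoscopic pair-order ceiling from a block kinetic budget (pre-assembly)

Support for the cruxes `NoInfraredPileUp` (stmt-HubbardSuperconductivity-18534) and
`NoNormalLimitState` (stmt-HubbardSuperconductivity-18533) of route `InfiniteVolumeFirst`: the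
assembly of the coarse-tightness / atom-ceiling programme (`PLAN-coarse-tightness.md` attached to
the item) up to its single remaining analytic input. For a unit vector `ψ` of the fermionic torus
`(ℤ/Lℤ)²`, a block side `R ≥ 1` with `2R + 2 ≤ L`, the product sine modes `φ_j = blockMode R j`
(`DirichletSineBasis`), the occupations `x_{aj} = ⟨n_↑(φ_j^{(a)})⟩` of the `↑` block modes at the
corner `a`, a level `μ` and a shell width `τ ∈ (0,1]`:

  **`mesoOrder_le_of_budget`** — if the level-weighted smearing summed over the translates obeys the
  BUDGET `Σ_a Σ_j |ε_j - μ| x_{aj}(1 - x_{aj}) ≤ Bud ≤ L² R² (U + C₂/R)`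
  (`ε_j = torusBand (2R+2) (blockMomentum R j)`, the block levels), then
  `(Σ_a ‖B_a ψ‖²)/(L² R⁴) ≤ 16512/R + 65536 √τ + (128/√τ) √(U + C₂/R)`.

Ingredients, all landed: the block pair Gram bound `blockPairGram_bound` with the sine basis
(`sum_blockMode_mul_blockMode`, the `d`-wave bridge `dWaveStepKernel_eq_sum_blockMode`,
`abs_dWaveBlockEigen_div_sqrt_two_le`: `κ₀ = 2√2`), the aggregation `sum_le_of_gram_shell_budget`,
the uniform block shell count `card_blockShell_le`, `|(ℤ/L)²| = L²` (`card_torusSite`), and the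
occupations `x_{aj} ∈ [0,1]` (`proj_modeUp`). Hence the hypothesised ceiling (MC) of
`InfiniteVolumeFirstCoarseTightnessCorollaries` — and with it coarse tightness and the atom ceiling
`≤ (65536 + 128) U^{1/4}` — follows from ONE statement about ground states: the budget
`Σ_a Σ_j |ε_j - μ_L| x_{aj}(1 - x_{aj}) ≤ L² R² (U + C₂/R)` for the unit ground states of
`hubbardTorus 2 L 1 U` in the sectors `(2n, 0)` (the block kinetic budget, step S5/S7/S8 of the
programme). Registered stub: `stub_coarseMesoOrderLeOfBudget`.

Sources: J. Bardeen, L. N. Cooper, J. R. Schrieffer, Phys. Rev. 108 (1957) 1175, §II; C. N. Yang,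
Rev. Mod. Phys. 34 (1962) 694, §3; G. Strang, SIAM Rev. 41 (1999) 135, §2 (discrete sine basis).
Elementary assembly; no definition and no named fact is introduced.
-/

noncomputable section

-- the mandated namespace `Summit.<Summit>.<Problem>.Theorems` repeats `HubbardSuperconductivity`
-- (single-problem summit, D-0017), which the `dupNamespace` linter flags on every declaration
set_option linter.dupNamespace false

namespace Summit.HubbardSuperconductivity.HubbardSuperconductivity.Theorems.CoarseTightness

open Literature.MathematicalPhysics.QuantumLattice Literature.Probability.LatticeModels Matrix Finset
open Literature.MathematicalPhysics.QuantumLattice.RayleighBound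
open scoped ComplexConjugate ComplexOrder

/-! ### The occupations of the block modes lie in `[0,1]` -/

/-- For a unit vector and `R ≤ L`, the occupation `x_{aj} = Re ⟨ψ, n_↑(φ_j^{(a)}) ψ⟩` of the `↑`
sine block mode lies in `[0,1]` (a Hermitian idempotent, `proj_modeUp`). [folklore] -/
theorem blockOccupation_mem_Icc {L : ℕ} [NeZero L] (a : TorusSite 2 L) {R : ℕ} (hRL : R ≤ L)
    (j : Fin 2 → Fin R) (ψ : Fock (Orb (FermionTorus 2 L))) (hψ : star ψ ⬝ᵥ ψ = 1) :
    (star ψ ⬝ᵥ (numberMode (Function.extend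
        (fun u : Fin 2 → Fin R => orb (FermionTorus.ofTorusSite (a + fun i => ((u i : ℕ) : ZMod L))) 0)
        (fun u => ((blockMode R j u : ℝ) : ℂ)) 0) *ᵥ ψ)).re ∈ Set.Icc (0:ℝ) 1 := by
  obtain ⟨h1, h2⟩ := proj_modeUp (blockOrb_injective a hRL 0) (blockMode R)
    (sum_blockMode_mul_blockMode R) j
  refine ⟨Literature.Computability.AlgebraicComplexity.re_dotProduct_mulVec_nonneg
      (show Matrix.IsHermitian _ from h1) h2 ψ, ?_⟩
  have h := Literature.Computability.AlgebraicComplexity.re_dotProduct_mulVec_le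
    (show Matrix.IsHermitian _ from h1) h2 ψ
  rw [hψ, Complex.one_re] at h
  exact h

/-! ### The mesoscopic pair order from the budget -/

/-- **The mesoscopic pair-order ceiling from a block kinetic budget.** For a unit vector `ψ` of the
fermionic torus, `1 ≤ R`, `2R + 2 ≤ L`, a level `μ`, a shell width `τ ∈ (0,1]`, `U, C₂ ≥ 0` and a
budget `Σ_a Σ_j |ε_j - μ| x_{aj}(1 - x_{aj}) ≤ Bud ≤ L² R² (U + C₂/R)` for the level-weighted
smearing of the `↑` sine block modes (`ε_j = torusBand (2R+2) (blockMomentum R j)`):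
`(Σ_a ‖B_a ψ‖²)/(L²R⁴) ≤ 16512/R + 65536 √τ + (128/√τ) √(U + C₂/R)`
(block Gram bound with `κ₀ = 2√2`, aggregation with the uniform shell count
`N = √τ (2R+2)² + 2(2R+2) ≤ 16 √τ R² + 8R`, and `τ ≤ √τ`, `1/R² ≤ 1/R`).
Bardeen–Cooper–Schrieffer (1957) §II; Yang (1962) §3. [folklore] -/
theorem mesoOrder_le_of_budget {L R : ℕ} [NeZero L] (hR : 1 ≤ R) (hRL : 2 * R + 2 ≤ L)
    (ψ : Fock (Orb (FermionTorus 2 L))) (hψ : star ψ ⬝ᵥ ψ = 1) (μ : ℝ) {τ : ℝ}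
    (hτ : τ ∈ Set.Ioc (0:ℝ) 1) {U C₂ Bud : ℝ} (hU : 0 ≤ U) (hC : 0 ≤ C₂)
    (hBud : Bud ≤ (L : ℝ) ^ 2 * (R : ℝ) ^ 2 * (U + C₂ / R))
    (hbud : ∑ a : TorusSite 2 L, ∑ j : Fin 2 → Fin R,
      |torusBand (2 * R + 2) (blockMomentum R j) - μ| *
        ((star ψ ⬝ᵥ (numberMode (Function.extend
            (fun u : Fin 2 → Fin R =>
              orb (FermionTorus.ofTorusSite (a + fun i => ((u i : ℕ) : ZMod L))) 0)
            (fun u => ((blockMode R j u : ℝ) : ℂ)) 0) *ᵥ ψ)).re *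
          (1 - (star ψ ⬝ᵥ (numberMode (Function.extend
            (fun u : Fin 2 → Fin R =>
              orb (FermionTorus.ofTorusSite (a + fun i => ((u i : ℕ) : ZMod L))) 0)
            (fun u => ((blockMode R j u : ℝ) : ℂ)) 0) *ᵥ ψ)).re)) ≤ Bud) :
    (∑ a : TorusSite 2 L, (star ((∑ u : Fin 2 → Fin R,
        localPair dWaveFormFactor L (a + fun i => ((u i : ℕ) : ZMod L))) *ᵥ ψ) ⬝ᵥ
      ((∑ u : Fin 2 → Fin R,
        localPair dWaveFormFactor L (a + fun i => ((u i : ℕ) : ZMod L))) *ᵥ ψ)).re) /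
        ((L : ℝ) ^ 2 * (R : ℝ) ^ 4) ≤
      16512 / R + 65536 * Real.sqrt τ + 128 / Real.sqrt τ * Real.sqrt (U + C₂ / R) := by
  classical
  have hRL' : R ≤ L := by omega
  have hRpos : (0:ℝ) < R := by exact_mod_cast hR
  have hLpos : (0:ℝ) < L := by
    have : (1 : ℕ) ≤ L := by omega
    exact_mod_cast this
  obtain ⟨hτ0, hτ1⟩ := hτ
  -- data of the aggregation lemma
  set X : TorusSite 2 L → (Fin 2 → Fin R) → ℝ := fun a j => (star ψ ⬝ᵥ (numberMode (Function.extend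
      (fun u : Fin 2 → Fin R =>
        orb (FermionTorus.ofTorusSite (a + fun i => ((u i : ℕ) : ZMod L))) 0)
      (fun u => ((blockMode R j u : ℝ) : ℂ)) 0) *ᵥ ψ)).re with hX
  set w : (Fin 2 → Fin R) → ℝ := fun j => |torusBand (2 * R + 2) (blockMomentum R j) - μ| with hw
  set m : TorusSite 2 L → ℝ := fun a => (star ((∑ u : Fin 2 → Fin R,
      localPair dWaveFormFactor L (a + fun i => ((u i : ℕ) : ZMod L))) *ᵥ ψ) ⬝ᵥ
    ((∑ u : Fin 2 → Fin R,
      localPair dWaveFormFactor L (a + fun i => ((u i : ℕ) : ZMod L))) *ᵥ ψ)).re with hm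
  have hx0 : ∀ a j, 0 ≤ X a j := fun a j => (blockOccupation_mem_Icc a hRL' j ψ hψ).1
  have hx1 : ∀ a j, X a j ≤ 1 := fun a j => (blockOccupation_mem_Icc a hRL' j ψ hψ).2
  have hw0 : ∀ j, 0 ≤ w j := fun j => abs_nonneg _
  -- the block pair Gram bounds, `κ₀ = 2√2`
  have hGram : ∀ a, m a ≤ 64 * (R : ℝ) ^ 2 + 64 * (∑ j, X a j +
      (∑ j, Real.sqrt (Real.sqrt (X a j * (1 - X a j)))) ^ 2) := by
    intro a
    have h := blockPairGram_bound a hRL' (blockMode R) (sum_blockMode_mul_blockMode R)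
      (fun j => blockEigen R (fun i => dWaveFormFactor (Pi.single i 1)) j / Real.sqrt 2)
      (2 * Real.sqrt 2) (abs_dWaveBlockEigen_div_sqrt_two_le R) (dWaveStepKernel_eq_sum_blockMode R)
      ψ hψ
    have h8 : (2 * Real.sqrt 2) ^ 2 = 8 := by
      rw [mul_pow, Real.sq_sqrt (by norm_num : (0:ℝ) ≤ 2)]; norm_num
    rw [h8] at h
    simp only [hm, hX]
    linarith
  -- the shell count
  set N : ℝ := Real.sqrt τ * ((2 * R + 2 : ℕ) : ℝ) ^ 2 + 2 * ((2 * R + 2 : ℕ) : ℝ) with hN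
  have hNc : (((Finset.univ : Finset (Fin 2 → Fin R)).filter fun j => w j ≤ τ).card : ℝ) ≤ N :=
    card_blockShell_le R μ τ
  -- aggregation
  have hAgg := sum_le_of_gram_shell_budget X hx0 hx1 w hw0 hτ0 hNc m (P := 64 * (R : ℝ) ^ 2)
    (Q := 64) (by norm_num) hGram hbud
  -- cardinalities
  have hcardA : (Fintype.card (TorusSite 2 L) : ℝ) = (L : ℝ) ^ 2 := by
    rw [card_torusSite]; push_cast; ring
  have hcardJ : (Fintype.card (Fin 2 → Fin R) : ℝ) = (R : ℝ) ^ 2 := by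
    rw [Fintype.card_fun, Fintype.card_fin, Fintype.card_fin]; push_cast; ring
  rw [hcardA, hcardJ] at hAgg
  -- `N ≤ 16 √τ R² + 8 R`, `N² ≤ 512 τ R⁴ + 128 R²`
  have hsτ : 0 ≤ Real.sqrt τ := Real.sqrt_nonneg _
  have h2R : ((2 * R + 2 : ℕ) : ℝ) ≤ 4 * R := by
    have : (2 * R + 2 : ℕ) ≤ 4 * R := by omega
    exact_mod_cast this
  have hNle : N ≤ 16 * Real.sqrt τ * (R : ℝ) ^ 2 + 8 * R := by
    have h1 : ((2 * R + 2 : ℕ) : ℝ) ^ 2 ≤ (4 * (R : ℝ)) ^ 2 :=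
      pow_le_pow_left₀ (by positivity) h2R 2
    simp only [hN]
    nlinarith [mul_le_mul_of_nonneg_left h1 hsτ]
  have hN0 : 0 ≤ N := by positivity
  have hN2 : N ^ 2 ≤ 512 * τ * (R : ℝ) ^ 4 + 128 * (R : ℝ) ^ 2 := by
    have h1 := pow_le_pow_left₀ hN0 hNle 2
    have h2 : (16 * Real.sqrt τ * (R : ℝ) ^ 2 + 8 * R) ^ 2 ≤
        2 * (16 * Real.sqrt τ * (R : ℝ) ^ 2) ^ 2 + 2 * (8 * (R : ℝ)) ^ 2 := by
      nlinarith [sq_nonneg (16 * Real.sqrt τ * (R : ℝ) ^ 2 - 8 * R)]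
    have h3 : 2 * (16 * Real.sqrt τ * (R : ℝ) ^ 2) ^ 2 + 2 * (8 * (R : ℝ)) ^ 2 =
        512 * τ * (R : ℝ) ^ 4 + 128 * (R : ℝ) ^ 2 := by
      rw [mul_pow, mul_pow, Real.sq_sqrt hτ0.le]; ring
    linarith
  -- the square root: `√((R²)³ (L² Bud)/τ) ≤ R⁴ L² √(U + C₂/R) / √τ`
  have hUC : 0 ≤ U + C₂ / R := by positivity
  set W : ℝ := Real.sqrt (U + C₂ / R) / Real.sqrt τ with hWdef
  have hW0 : 0 ≤ W := by positivity
  have hsq : Real.sqrt (((R : ℝ) ^ 2) ^ 3 * ((L : ℝ) ^ 2 * Bud) / τ) ≤ (R : ℝ) ^ 4 * (L : ℝ) ^ 2 * W := by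
    have hrhs : ((R : ℝ) ^ 4 * (L : ℝ) ^ 2 * W) ^ 2 = (R : ℝ) ^ 8 * (L : ℝ) ^ 4 * ((U + C₂ / R) / τ) := by
      rw [hWdef, mul_pow, mul_pow, div_pow, Real.sq_sqrt hUC, Real.sq_sqrt hτ0.le]; ring
    have hle0 : ((R : ℝ) ^ 2) ^ 3 * ((L : ℝ) ^ 2 * Bud) ≤ (R : ℝ) ^ 8 * (L : ℝ) ^ 4 * (U + C₂ / R) := by
      have h := mul_le_mul_of_nonneg_left hBud (by positivity : (0:ℝ) ≤ (R : ℝ) ^ 6 * (L : ℝ) ^ 2)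
      calc ((R : ℝ) ^ 2) ^ 3 * ((L : ℝ) ^ 2 * Bud) = (R : ℝ) ^ 6 * (L : ℝ) ^ 2 * Bud := by ring
        _ ≤ (R : ℝ) ^ 6 * (L : ℝ) ^ 2 * ((L : ℝ) ^ 2 * (R : ℝ) ^ 2 * (U + C₂ / R)) := h
        _ = (R : ℝ) ^ 8 * (L : ℝ) ^ 4 * (U + C₂ / R) := by ring
    have hle : ((R : ℝ) ^ 2) ^ 3 * ((L : ℝ) ^ 2 * Bud) / τ ≤ ((R : ℝ) ^ 4 * (L : ℝ) ^ 2 * W) ^ 2 := by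
      rw [hrhs, ← mul_div_assoc]
      exact div_le_div_of_nonneg_right hle0 hτ0.le
    calc Real.sqrt (((R : ℝ) ^ 2) ^ 3 * ((L : ℝ) ^ 2 * Bud) / τ)
        ≤ Real.sqrt (((R : ℝ) ^ 4 * (L : ℝ) ^ 2 * W) ^ 2) := Real.sqrt_le_sqrt hle
      _ = (R : ℝ) ^ 4 * (L : ℝ) ^ 2 * W := Real.sqrt_sq (by positivity)
  -- divide by `L² R⁴`
  have hτle : τ ≤ Real.sqrt τ := by
    have h := Real.sqrt_le_sqrt hτ1
    rw [Real.sqrt_one] at h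
    calc τ = Real.sqrt τ * Real.sqrt τ := (Real.mul_self_sqrt hτ0.le).symm
      _ ≤ Real.sqrt τ * 1 := mul_le_mul_of_nonneg_left h hsτ
      _ = Real.sqrt τ := mul_one _
  have hR1 : (1:ℝ) ≤ R := by exact_mod_cast hR
  rw [div_le_iff₀ (by positivity)]
  have hS := hAgg
  -- total: `Σ_a m_a ≤ L²(128 R² + 128 N²) + 128 √(…) ≤ …`
  have hT1 : (L : ℝ) ^ 2 * (64 * (R : ℝ) ^ 2 + 64 * (R : ℝ) ^ 2 + 2 * 64 * N ^ 2) ≤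
      16512 * (L : ℝ) ^ 2 * (R : ℝ) ^ 3 + 65536 * Real.sqrt τ * (L : ℝ) ^ 2 * (R : ℝ) ^ 4 := by
    have hA : (R : ℝ) ^ 2 ≤ (R : ℝ) ^ 3 :=
      calc (R : ℝ) ^ 2 = (R : ℝ) ^ 2 * 1 := by ring
        _ ≤ (R : ℝ) ^ 2 * R := mul_le_mul_of_nonneg_left hR1 (by positivity)
        _ = (R : ℝ) ^ 3 := by ring
    have hB : τ * (R : ℝ) ^ 4 ≤ Real.sqrt τ * (R : ℝ) ^ 4 := mul_le_mul_of_nonneg_right hτle (by positivity)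
    have hL2 : (0:ℝ) ≤ (L : ℝ) ^ 2 := by positivity
    have e1 : (L : ℝ) ^ 2 * N ^ 2 ≤ (L : ℝ) ^ 2 * (512 * τ * (R : ℝ) ^ 4 + 128 * (R : ℝ) ^ 2) :=
      mul_le_mul_of_nonneg_left hN2 hL2
    have e2 : (L : ℝ) ^ 2 * (R : ℝ) ^ 2 ≤ (L : ℝ) ^ 2 * (R : ℝ) ^ 3 := mul_le_mul_of_nonneg_left hA hL2
    have e3 : (L : ℝ) ^ 2 * (τ * (R : ℝ) ^ 4) ≤ (L : ℝ) ^ 2 * (Real.sqrt τ * (R : ℝ) ^ 4) :=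
      mul_le_mul_of_nonneg_left hB hL2
    calc (L : ℝ) ^ 2 * (64 * (R : ℝ) ^ 2 + 64 * (R : ℝ) ^ 2 + 2 * 64 * N ^ 2)
        = 128 * ((L : ℝ) ^ 2 * (R : ℝ) ^ 2) + 128 * ((L : ℝ) ^ 2 * N ^ 2) := by ring
      _ ≤ 128 * ((L : ℝ) ^ 2 * (R : ℝ) ^ 2) +
          128 * ((L : ℝ) ^ 2 * (512 * τ * (R : ℝ) ^ 4 + 128 * (R : ℝ) ^ 2)) := by linarith
      _ = 16512 * ((L : ℝ) ^ 2 * (R : ℝ) ^ 2) + 65536 * ((L : ℝ) ^ 2 * (τ * (R : ℝ) ^ 4)) := by ring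
      _ ≤ 16512 * ((L : ℝ) ^ 2 * (R : ℝ) ^ 3) + 65536 * ((L : ℝ) ^ 2 * (Real.sqrt τ * (R : ℝ) ^ 4)) := by
          linarith
      _ = 16512 * (L : ℝ) ^ 2 * (R : ℝ) ^ 3 + 65536 * Real.sqrt τ * (L : ℝ) ^ 2 * (R : ℝ) ^ 4 := by ring
  have hT2 : 2 * 64 * Real.sqrt (((R : ℝ) ^ 2) ^ 3 * ((L : ℝ) ^ 2 * Bud) / τ) ≤
      128 * ((R : ℝ) ^ 4 * (L : ℝ) ^ 2 * W) := by linarith [hsq]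
  calc ∑ a, m a ≤ (L : ℝ) ^ 2 * (64 * (R : ℝ) ^ 2 + 64 * (R : ℝ) ^ 2 + 2 * 64 * N ^ 2) +
        2 * 64 * Real.sqrt (((R : ℝ) ^ 2) ^ 3 * ((L : ℝ) ^ 2 * Bud) / τ) := hS
    _ ≤ 16512 * (L : ℝ) ^ 2 * (R : ℝ) ^ 3 + 65536 * Real.sqrt τ * (L : ℝ) ^ 2 * (R : ℝ) ^ 4 +
        128 * ((R : ℝ) ^ 4 * (L : ℝ) ^ 2 * W) := add_le_add hT1 hT2
    _ = (16512 / R + 65536 * Real.sqrt τ + 128 / Real.sqrt τ * Real.sqrt (U + C₂ / R)) *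
        ((L : ℝ) ^ 2 * (R : ℝ) ^ 4) := by
        rw [hWdef]
        field_simp

/-- **Registered stub** (`stub_coarseMesoOrderLeOfBudget`, crux stmt-HubbardSuperconductivity-18534):
the mesoscopic pair-order ceiling of a unit torus vector from a block kinetic budget for the
level-weighted smearing of its `↑` sine block modes.
Bardeen–Cooper–Schrieffer (1957) §II; Yang (1962) §3. [folklore] -/
theorem stub_coarseMesoOrderLeOfBudget :
    ∀ (L : ℕ) [NeZero L] (R : ℕ), 1 ≤ R → 2 * R + 2 ≤ L →
      ∀ (ψ : Fock (Orb (FermionTorus 2 L))), star ψ ⬝ᵥ ψ = 1 → ∀ (μ τ : ℝ), τ ∈ Set.Ioc (0:ℝ) 1 →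
        ∀ (U C₂ Bud : ℝ), 0 ≤ U → 0 ≤ C₂ → Bud ≤ (L : ℝ) ^ 2 * (R : ℝ) ^ 2 * (U + C₂ / R) →
          (∑ a : TorusSite 2 L, ∑ j : Fin 2 → Fin R,
            |torusBand (2 * R + 2) (blockMomentum R j) - μ| *
              ((star ψ ⬝ᵥ (numberMode (Function.extend
                  (fun u : Fin 2 → Fin R =>
                    orb (FermionTorus.ofTorusSite (a + fun i => ((u i : ℕ) : ZMod L))) 0)
                  (fun u => ((blockMode R j u : ℝ) : ℂ)) 0) *ᵥ ψ)).re *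
                (1 - (star ψ ⬝ᵥ (numberMode (Function.extend
                  (fun u : Fin 2 → Fin R =>
                    orb (FermionTorus.ofTorusSite (a + fun i => ((u i : ℕ) : ZMod L))) 0)
                  (fun u => ((blockMode R j u : ℝ) : ℂ)) 0) *ᵥ ψ)).re)) ≤ Bud) →
          (∑ a : TorusSite 2 L, (star ((∑ u : Fin 2 → Fin R,
              localPair dWaveFormFactor L (a + fun i => ((u i : ℕ) : ZMod L))) *ᵥ ψ) ⬝ᵥ
            ((∑ u : Fin 2 → Fin R,
              localPair dWaveFormFactor L (a + fun i => ((u i : ℕ) : ZMod L))) *ᵥ ψ)).re) /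
              ((L : ℝ) ^ 2 * (R : ℝ) ^ 4) ≤
            16512 / R + 65536 * Real.sqrt τ + 128 / Real.sqrt τ * Real.sqrt (U + C₂ / R) :=
  fun _ _ _ hR hRL ψ hψ μ _ hτ _ _ _ hU hC hBud hbud =>
    mesoOrder_le_of_budget hR hRL ψ hψ μ hτ hU hC hBud hbud

end Summit.HubbardSuperconductivity.HubbardSuperconductivity.Theorems.CoarseTightness

end
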